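import Summits.CriticalPhenomena.PercolationContinuityZ3.Theorems.PercNearOneGluingAdditiveGluingBlockGoodPeel
import Summits.CriticalPhenomena.PercolationContinuityZ3.Theorems.PercNearOneGluingAdditiveGluingBlockGoodCardFourReduction
import HarnessLib

/-! # Crux `PercNearOneGluing.AdditiveGluing` (stmt-CriticalPhenomena-4576), kernel `residualKernel_two` — the ONE-DELETION leaf
# (`blockGood_two_of_eraseMin`): peel one block vertex, close every child by a leaf

Invested seat `xfam-b` (cross-family direct attempt B on `residualKernel_two`); lands `--supports stmt-CriticalPhenomena-4576`; no
definitions, no named facts.  `BG(u, A, S, b, a₀, sel)` = block goodness of the un-glued graph (conclusion of the residual kernel).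

For a two-vertex block `S = {x, y}` peel `x` with the exact σ-peel `blockGood_peel` (H5): the children are the blocks `{y} ∪ B` in the
graph `u − x`, `B` a positive layer of the open star of `x`.  If every positive-weight neighbour of `x` lies in `A ∪ {y}` (always the case
in the first open instance `n = 6`, `V = A ∪ S`), every child is closed by a LEAF as soon as the designated relay `a₀` is still a
minimiser of `μ_{u−x}(· ↔ b)` over `A`:
* `B ∋ b`: `blockGood_of_target_mem_block`;  `B ∋ a₀`: `blockGood_of_designated_mem_block` (this file: the two-point side of BG is then
  `μ(block ↔ b)` itself and the slack is the pocket sum);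
* `B` meets `A` elsewhere, at a relay `v`: the Lemma-5 leaf `blockGood_leaf_lemma5` in `u − x` (`μ_{u−x}(a₀↔b) ≤ μ_{u−x}(v↔b)`);
* `B ⊆ {y}`: the child is the single vertex `y`, closed by the induction-hypothesis leaf `blockGood_leaf_ih` — this is where the goodness
  of `(u − x, A, y, b)` (the induction hypothesis handed to the residual kernel by `goodStep_of_residualKernelIH`) is consumed.
So (**`blockGood_two_of_eraseMin`**) the 2-block kernel holds whenever `a₀` survives the deletion of ONE block vertex as a minimiser
(by symmetry, of either).  Exact enumeration at `n = 6` (this seat's `lab/k6f`): among instances of `residualKernel_two` with deletion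
drift (`argmin_A μ_{u−S} ≠ a₀`, i.e. not already closed by `blockGood_leaf_delMin`) about two thirds satisfy the hypothesis for `x` or
for `y`; the open core of the `n = 6` instance is thus: `a₀` minimal in `u` but in NONE of `u − x`, `u − y`, `u − S`.
[cite: KozmaNitzan2024, §3.2 (Thm 5 p. 13, Lemma 5 p. 13, proof p. 14)]
-/

namespace Summit.CriticalPhenomena.PercolationContinuityZ3.Theorems

open MeasureTheory Set
open Literature.Probability.LatticeModels (prodBernoulli)
open Literature.Probability.Percolation (BondConfig openConn openConnIn openGraph openCluster)
open scoped BigOperators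

noncomputable section
open Classical

section BlockGoodTwoEraseMin

open Literature.Probability.LatticeModels Literature.Probability.Percolation

variable {n : ℕ}

/-- `BG` is the pocket inequality when the designated relay lies in the block: then `μ(a₀↔b) + μ(a₀↮b, a₀↔S, S↔b) = μ(S↔b)`.
[folklore] -/
theorem blockGood_of_designated_mem_block (u : Sym2 (Fin n) → unitInterval) (A S : Finset (Fin n)) (b a₀ : Fin n)
    (sel : Finset (Fin n) → Fin n) (ha₀S : a₀ ∈ S) :
    (prodBernoulli u).real (openConn a₀ b)
        + (prodBernoulli u).real
            ((openConn a₀ b)ᶜ ∩ (⋃ s ∈ S, openConn a₀ s) ∩ (⋃ s ∈ S, openConn s b))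
      ≤ (prodBernoulli u).real (⋃ s ∈ S, openConn s b)
        + ∑ W ∈ (Finset.univ : Finset (Finset (Fin n))).filter (fun W => Disjoint W A),
            (prodBernoulli u).real {ω : BondConfig (Fin n) | ∀ z : Fin n, (z ∈ W ↔ ω ∈ ⋃ s ∈ S, openConn s z)}
              * (prodBernoulli u).real (openConnIn ((W : Set (Fin n))ᶜ) (sel W) b) := by
  have hsub : (openConn a₀ b : Set (BondConfig (Fin n))) ⊆ ⋃ s ∈ S, openConn s b :=
    fun ω hω => Set.mem_iUnion₂.2 ⟨a₀, ha₀S, hω⟩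
  have hX : (⋃ s ∈ S, openConn a₀ s : Set (BondConfig (Fin n))) = Set.univ :=
    Set.eq_univ_of_forall fun ω => Set.mem_iUnion₂.2 ⟨a₀, ha₀S, (SimpleGraph.Reachable.refl a₀ : (openGraph ω).Reachable a₀ a₀)⟩
  have heq : (prodBernoulli u).real (openConn a₀ b)
      + (prodBernoulli u).real ((openConn a₀ b)ᶜ ∩ (⋃ s ∈ S, openConn a₀ s) ∩ (⋃ s ∈ S, openConn s b)) =
      (prodBernoulli u).real (⋃ s ∈ S, openConn s b) := by
    rw [hX, Set.inter_univ, ← measureReal_union (Set.disjoint_left.2 fun ω h h' => h'.1 h) MeasurableSet.of_discrete]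
    congr 1
    ext ω
    simp only [Set.mem_union, Set.mem_inter_iff, Set.mem_compl_iff]
    constructor
    · rintro (h | ⟨-, h⟩)
      exacts [hsub h, h]
    · intro h
      by_cases h' : ω ∈ openConn a₀ b
      exacts [Or.inl h', Or.inr ⟨h', h⟩]
  rw [heq]
  exact le_add_of_nonneg_right (Finset.sum_nonneg fun _ _ => mul_nonneg measureReal_nonneg measureReal_nonneg)

/-- **The one-deletion leaf for a two-vertex block.**  Let `S = {x, y}` with `x ≠ y`, `x, y ∉ A`, `b, a₀ ∈ A`, and suppose every
positive-weight neighbour of `x` lies in `A ∪ {y}`.  If `a₀` minimises `μ_{u−x}(· ↔ b)` over `A` and the quadruple `(u − x, A, y, b)` is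
good (selection form, every level and selection), then `BG(u, A, {x, y}, b, a₀, sel)` for every selection `sel W ∈ A`.
See the module docstring. [cite: KozmaNitzan2024, §3.2 (Thm 5 p. 13, Lemma 5 p. 13, proof p. 14)] -/
theorem blockGood_two_of_eraseMin (u : Sym2 (Fin n) → unitInterval) (A : Finset (Fin n)) (b a₀ x y : Fin n)
    (sel : Finset (Fin n) → Fin n) (hxy : x ≠ y) (hxA : x ∉ A) (hyA : y ∉ A) (hbA : b ∈ A) (ha₀A : a₀ ∈ A)
    (hsel : ∀ W, sel W ∈ A)
    (hnbr : ∀ z : Fin n, (u s(x, z) : ℝ) ≠ 0 → z ∈ A ∨ z = y)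
    (hmin : ∀ a ∈ A, (prodBernoulli (fun e : Sym2 (Fin n) => if ∃ z ∈ ({x} : Finset (Fin n)), z ∈ e then (0 : unitInterval) else u e)).real (openConn a₀ b) ≤ (prodBernoulli (fun e : Sym2 (Fin n) => if ∃ z ∈ ({x} : Finset (Fin n)), z ∈ e then (0 : unitInterval) else u e)).real (openConn a b))
    (hgood : ∀ (t : ℝ) (sel' : Finset (Fin n) → Fin n), (∀ W, sel' W ∈ A) →
      (∀ a ∈ A, 1 - t ≤ (prodBernoulli (fun e : Sym2 (Fin n) => if ∃ z ∈ ({x} : Finset (Fin n)), z ∈ e then (0 : unitInterval) else u e)).real (openConn a b)) →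
      (prodBernoulli (fun e : Sym2 (Fin n) => if ∃ z ∈ ({x} : Finset (Fin n)), z ∈ e then (0 : unitInterval) else u e)).real ((⋃ a ∈ A, openConn y a) ∩ (openConn y b)ᶜ)
        + ∑ W ∈ (Finset.univ : Finset (Finset (Fin n))).filter (fun W => y ∈ W ∧ Disjoint W A),
            (prodBernoulli (fun e : Sym2 (Fin n) => if ∃ z ∈ ({x} : Finset (Fin n)), z ∈ e then (0 : unitInterval) else u e)).real {ω : BondConfig (Fin n) | openCluster ω y = (W : Set (Fin n))}
              * (prodBernoulli (fun e : Sym2 (Fin n) => if ∃ z ∈ ({x} : Finset (Fin n)), z ∈ e then (0 : unitInterval) else u e)).real (openConnIn ((W : Set (Fin n))ᶜ) (sel' W) b)ᶜ ≤ t) :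
    (prodBernoulli u).real (openConn a₀ b)
        + (prodBernoulli u).real
            ((openConn a₀ b)ᶜ ∩ (⋃ s ∈ ({x, y} : Finset (Fin n)), openConn a₀ s) ∩ (⋃ s ∈ ({x, y} : Finset (Fin n)), openConn s b))
      ≤ (prodBernoulli u).real (⋃ s ∈ ({x, y} : Finset (Fin n)), openConn s b)
        + ∑ W ∈ (Finset.univ : Finset (Finset (Fin n))).filter (fun W => Disjoint W A),
            (prodBernoulli u).real {ω : BondConfig (Fin n) | ∀ z : Fin n, (z ∈ W ↔ ω ∈ ⋃ s ∈ ({x, y} : Finset (Fin n)), openConn s z)}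
              * (prodBernoulli u).real (openConnIn ((W : Set (Fin n))ᶜ) (sel W) b) := by
  have hxS : x ∈ ({x, y} : Finset (Fin n)) := Finset.mem_insert_self x {y}
  refine blockGood_peel u A {x, y} b a₀ x sel hxS hxA hbA ha₀A hsel ?_
  intro S' hS'
  -- every vertex of a positive layer is a positive-weight neighbour of `x`, hence in `A ∪ {y}`; and `x ∉ S'`
  have hS'w : ∀ z ∈ S', (u s(x, z) : ℝ) ≠ 0 := by
    intro z hz h0
    refine hS' (le_antisymm ?_ measureReal_nonneg)
    have hsub : {ω : BondConfig (Fin n) | ∀ w : Fin n, w ∈ S' ↔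
          (w ∉ ({x} : Finset (Fin n)) ∧ ∃ o ∈ ({x} : Finset (Fin n)), s(o, w) ∈ ω)}
        ⊆ {ω : BondConfig (Fin n) | s(x, z) ∈ ω} := by
      intro ω hω
      obtain ⟨-, o, ho, hoz⟩ := (hω z).1 hz
      rw [Finset.mem_singleton] at ho
      subst ho
      exact hoz
    refine (measureReal_mono hsub (measure_ne_top _ _)).trans (le_of_eq ?_)
    rw [prodBernoulli_real_setOf_mem]
    exact h0
  have hS'sub : ∀ z ∈ S', z ∈ A ∨ z = y := fun z hz => hnbr z (hS'w z hz)
  -- the child block is `{y} ∪ S'`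
  have hchild : ({x, y} : Finset (Fin n)).erase x ∪ S' = insert y S' := by
    rw [Finset.erase_insert (by rwa [Finset.mem_singleton]), ← Finset.insert_eq]
  rw [hchild]
  by_cases hbS : b ∈ S'
  · exact blockGood_of_target_mem_block _ A _ b a₀ _ (Finset.mem_insert_of_mem hbS)
  by_cases haS : a₀ ∈ S'
  · exact blockGood_of_designated_mem_block _ A _ b a₀ _ (Finset.mem_insert_of_mem haS)
  by_cases hAS : ∃ v ∈ S', v ∈ A
  · -- a relay in the layer: the Lemma-5 leaf in `u − x`
    obtain ⟨v, hvS, hvA⟩ := hAS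
    have hbT : b ∉ insert y S' := by
      rw [Finset.mem_insert, not_or]
      exact ⟨fun h => hyA (h ▸ hbA), hbS⟩
    exact blockGood_leaf_lemma5 _ A _ b a₀ v _ (Finset.mem_insert_of_mem hvS) hbT (hmin v hvA)
  · -- the layer misses `A`: the child is the single vertex `y`; the induction-hypothesis leaf
    push Not at hAS
    have hT : insert y S' = ({y} : Finset (Fin n)) := by
      refine Finset.eq_singleton_iff_unique_mem.2 ⟨Finset.mem_insert_self y S', fun z hz => ?_⟩
      rcases Finset.mem_insert.1 hz with rfl | hzS
      · rfl
      · exact (hS'sub z hzS).resolve_left (hAS z hzS)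
    rw [hT]
    have hglue := goodStep24_glue_singleton (fun e : Sym2 (Fin n) => if ∃ z ∈ ({x} : Finset (Fin n)), z ∈ e then (0 : unitInterval) else u e) y
    refine blockGood_leaf_ih _ A {y} b a₀ y _ (Finset.mem_singleton_self y) hbA (fun W' => hsel _) ?_ ?_
    · rw [hglue]
      exact hmin
    · rw [hglue]
      exact hgood

end BlockGoodTwoEraseMin

open Literature.Probability.LatticeModels Literature.Probability.Percolation in
/-- Registered helper stub `stub_blockGoodTwoOfEraseMin_xb` (invested seat xfam-b): the one-deletion leaf of the 2-block kernel — `BG` for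
`S = {x, y}` whenever `a₀` is still a minimiser after deleting `x` and `(u − x, A, y, b)` is good (= `blockGood_two_of_eraseMin`).
[cite: KozmaNitzan2024, §3.2 (Thm 5 p. 13, Lemma 5 p. 13)] -/
theorem stub_blockGoodTwoOfEraseMin_xb : ∀ (n : ℕ) (u : Sym2 (Fin n) → unitInterval) (A : Finset (Fin n)) (b a₀ x y : Fin n) (sel : Finset (Fin n) → Fin n), x ≠ y → x ∉ A → y ∉ A → b ∈ A → a₀ ∈ A → (∀ W, sel W ∈ A) → (∀ z : Fin n, (u s(x, z) : ℝ) ≠ 0 → z ∈ A ∨ z = y) → (∀ a ∈ A, (prodBernoulli (fun e : Sym2 (Fin n) => if ∃ z ∈ ({x} : Finset (Fin n)), z ∈ e then (0 : unitInterval) else u e)).real (openConn a₀ b) ≤ (prodBernoulli (fun e : Sym2 (Fin n) => if ∃ z ∈ ({x} : Finset (Fin n)), z ∈ e then (0 : unitInterval) else u e)).real (openConn a b)) → (∀ (t : ℝ) (sel' : Finset (Fin n) → Fin n), (∀ W, sel' W ∈ A) → (∀ a ∈ A, 1 - t ≤ (prodBernoulli (fun e : Sym2 (Fin n) => if ∃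 z ∈ ({x} : Finset (Fin n)), z ∈ e then (0 : unitInterval) else u e)).real (openConn a b)) → (prodBernoulli (fun e : Sym2 (Fin n) => if ∃ z ∈ ({x} : Finset (Fin n)), z ∈ e then (0 : unitInterval) else u e)).real ((⋃ a ∈ A, openConn y a) ∩ (openConn y b)ᶜ) + ∑ W ∈ (Finset.univ : Finset (Finset (Fin n))).filter (fun W => y ∈ W ∧ Disjoint W A), (prodBernoulli (fun e : Sym2 (Fin n) => if ∃ z ∈ ({x} : Finset (Fin n)), z ∈ e then (0 : unitInterval) else u e)).real {ω : BondConfig (Fin n) | openCluster ω y = (W : Set (Fin n))} * (prodBernoulli (fun e : Sym2 (Fin n) => if ∃ z ∈ ({x} : Finset (Fin n)), z ∈ e then (0 : unitInterval) else u e)).real (openConnIn ((W : Set (Fin n))ᶜ) (sel' W) b)ᶜ ≤ t) → (prodBernoulli u).real (openConn a₀ b) + (prodBernoulli u).real ((openConn a₀ b)ᶜ ∩ (⋃ s ∈ ({x, y} : Finset (Fin n)), openConn a₀ s) ∩ (⋃ s ∈ ({x, y} : Finset (Fin n)), openConn s b)) ≤ (prodBernoulli u).real (⋃ s ∈ ({x,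 y} : Finset (Fin n)), openConn s b) + ∑ W ∈ (Finset.univ : Finset (Finset (Fin n))).filter (fun W => Disjoint W A), (prodBernoulli u).real {ω : BondConfig (Fin n) | ∀ z : Fin n, (z ∈ W ↔ ω ∈ ⋃ s ∈ ({x, y} : Finset (Fin n)), openConn s z)} * (prodBernoulli u).real (openConnIn ((W : Set (Fin n))ᶜ) (sel W) b) :=
  fun _ u A b a₀ x y sel hxy hxA hyA hbA ha₀A hsel hnbr hmin hgood =>
    blockGood_two_of_eraseMin u A b a₀ x y sel hxy hxA hyA hbA ha₀A hsel hnbr hmin hgood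

end

end Summit.CriticalPhenomena.PercolationContinuityZ3.Theorems
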